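import Summits.CriticalPhenomena.PercolationContinuityZ3.Theorems.SahiMasterFamilyFCombShiftBasic
import HarnessLib

/-!
# Down-shifts and reflections: a full down-shift forgets the antipode

Support file (cell `prim-bnk`, seat bnk-2 gen 21; `--supports stmt-CriticalPhenomena-4575`; complete write-up
`run/shared/lean/prim/prim-l12/PROOF-F-inequality.md`).  No definition, no `sorry`, standard axioms.  Part of the proof of the comb
inequality `K(A,B,G) ≥ 0` for ALL monotone third events `G`, hence of the master-family inequality
`(1+μG)μ(A∩B∩G) ≥ μG·μ(A∩B) + μ(A∩G)μ(B∩G)` for all increasing `A,B,G` and every product measure (`…FCombAllThirdEvents`).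

THIS FILE: `dn i` absorbs a reflection of coordinate `i` and commutes with reflections of the other coordinates; hence
`dnSeq s (σX) = dnSeq s X` whenever `s` contains every coordinate (`dnSeq_image_antipode`).  (Equivalently: the full up-compression is
`σ ∘` the full down-shift in the same order.) [this work; folklore]
-/

namespace Summit.CriticalPhenomena.PercolationContinuityZ3.Theorems

namespace SahiFComb

open Finset

variable {n : ℕ}

/-! ### 9. Reflections: the full down-shift is invariant under the antipode -/

/-- Reflections are involutions. [folklore] -/
theorem flipOn_flipOn (J : Finset (Fin n)) (x : Fin n → Bool) : flipOn J (flipOn J x) = x := by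
  funext k; unfold flipOn; split_ifs <;> simp

/-- Reflections are injective. [folklore] -/
theorem flipOn_injective (J : Finset (Fin n)) : Function.Injective (flipOn J : (Fin n → Bool) → (Fin n → Bool)) :=
  fun x y h => by rw [← flipOn_flipOn J x, h, flipOn_flipOn]

/-- Membership in a reflected family. [folklore] -/
theorem mem_image_flipOn {J : Finset (Fin n)} {X : Finset (Fin n → Bool)} {x : Fin n → Bool} :
    x ∈ X.image (flipOn J) ↔ flipOn J x ∈ X := by
  rw [Finset.mem_image]
  constructor
  · rintro ⟨y, hy, rfl⟩; rw [flipOn_flipOn]; exact hy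
  · intro h; exact ⟨flipOn J x, h, flipOn_flipOn J x⟩

/-- A reflected coordinate. [folklore] -/
theorem flipOn_apply_of_mem {J : Finset (Fin n)} {k : Fin n} (hk : k ∈ J) (x : Fin n → Bool) :
    flipOn J x k = !x k := by unfold flipOn; rw [if_pos hk]

/-- An unreflected coordinate. [folklore] -/
theorem flipOn_apply_of_not_mem {J : Finset (Fin n)} {k : Fin n} (hk : k ∉ J) (x : Fin n → Bool) :
    flipOn J x k = x k := by unfold flipOn; rw [if_neg hk]

/-- Reflecting coordinates outside `i` commutes with updating coordinate `i`. -/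
theorem flipOn_update_of_not_mem {J : Finset (Fin n)} {i : Fin n} (hi : i ∉ J) (x : Fin n → Bool) (b : Bool) :
    flipOn J (Function.update x i b) = Function.update (flipOn J x) i b := by
  funext k
  by_cases hk : k = i
  · subst hk; rw [flipOn_apply_of_not_mem hi]; simp
  · unfold flipOn; rw [Function.update_of_ne hk, Function.update_of_ne hk]

/-- Reflecting coordinate `i` (alone) turns `update x i b` into `update x i (!b)`... as needed below:
`flipOn {i} x = update x i (!x i)`. -/
theorem flipOn_singleton_eq_update (i : Fin n) (x : Fin n → Bool) :
    flipOn {i} x = Function.update x i (!x i) := by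
  funext k
  by_cases hk : k = i
  · subst hk; rw [flipOn_apply_of_mem (Finset.mem_singleton_self _)]; simp
  · rw [flipOn_apply_of_not_mem (by simpa using hk), Function.update_of_ne hk]

/-- Absorption: down-shifting along `i` forgets a reflection of coordinate `i`. -/
theorem dn_image_flipOn_singleton (i : Fin n) (X : Finset (Fin n → Bool)) :
    dn i (X.image (flipOn {i})) = dn i X := by
  ext x
  rw [mem_dn, mem_dn, mem_image_flipOn, mem_image_flipOn, mem_image_flipOn,
    flipOn_singleton_eq_update, flipOn_singleton_eq_update, flipOn_singleton_eq_update]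
  simp only [Function.update_self, update_update_same']
  cases hxi : x i
  · simp only [Bool.not_false, Bool.not_true]
    rw [update_eq_self_of_eq x i false hxi]
    tauto
  · simp only [Bool.not_true, Bool.not_false]
    rw [update_eq_self_of_eq x i true hxi]
    tauto

/-- Commutation: down-shifting along `i` commutes with reflecting other coordinates. -/
theorem dn_image_flipOn_of_not_mem {J : Finset (Fin n)} {i : Fin n} (hi : i ∉ J) (X : Finset (Fin n → Bool)) :
    dn i (X.image (flipOn J)) = (dn i X).image (flipOn J) := by
  ext x
  rw [mem_image_flipOn, mem_dn, mem_dn, mem_image_flipOn, mem_image_flipOn, mem_image_flipOn,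
    flipOn_update_of_not_mem hi, flipOn_update_of_not_mem hi, flipOn_apply_of_not_mem hi]

/-- Splitting off one reflected coordinate. [folklore] -/
theorem flipOn_erase_comp {J : Finset (Fin n)} {i : Fin n} (hi : i ∈ J) (x : Fin n → Bool) :
    flipOn J x = flipOn {i} (flipOn (J.erase i) x) := by
  funext k
  by_cases hk : k = i
  · subst hk
    rw [flipOn_apply_of_mem hi, flipOn_apply_of_mem (Finset.mem_singleton_self _),
      flipOn_apply_of_not_mem (Finset.notMem_erase _ _)]
  · have hki : k ∉ ({i} : Finset (Fin n)) := by simpa using hk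
    rw [flipOn_apply_of_not_mem hki]
    by_cases hkJ : k ∈ J
    · rw [flipOn_apply_of_mem hkJ, flipOn_apply_of_mem (Finset.mem_erase.mpr ⟨hk, hkJ⟩)]
    · rw [flipOn_apply_of_not_mem hkJ, flipOn_apply_of_not_mem (fun h => hkJ (Finset.mem_of_mem_erase h))]

/-- One down-shift step consumes coordinate `i` from the reflection set. -/
theorem dn_image_flipOn (J : Finset (Fin n)) (i : Fin n) (X : Finset (Fin n → Bool)) :
    dn i (X.image (flipOn J)) = (dn i X).image (flipOn (J.erase i)) := by
  by_cases hi : i ∈ J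
  · have himg : X.image (flipOn J) = (X.image (flipOn (J.erase i))).image (flipOn {i}) := by
      rw [Finset.image_image]
      congr 1
      funext x
      exact flipOn_erase_comp hi x
    rw [himg, dn_image_flipOn_singleton, dn_image_flipOn_of_not_mem (Finset.notMem_erase _ _)]
  · rw [Finset.erase_eq_of_notMem hi, dn_image_flipOn_of_not_mem hi]

/-- Iterated down-shifts consume the shifted coordinates from the reflection set. [this work] -/
theorem dnSeq_image_flipOn (s : List (Fin n)) : ∀ (J : Finset (Fin n)) (X : Finset (Fin n → Bool)),
    dnSeq s (X.image (flipOn J)) = (dnSeq s X).image (flipOn (J \ s.toFinset)) := by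
  induction s with
  | nil => intro J X; simp [dnSeq_nil]
  | cons i s ih =>
    intro J X
    rw [dnSeq_cons, dnSeq_cons, dn_image_flipOn, ih]
    congr 2
    ext k
    simp [Finset.mem_sdiff, Finset.mem_erase]
    tauto

/-- **σ-invariance.** A down-shift along a list containing every coordinate forgets the antipode. -/
theorem dnSeq_image_antipode (s : List (Fin n)) (hs : ∀ i, i ∈ s) (X : Finset (Fin n → Bool)) :
    dnSeq s (X.image (flipOn Finset.univ)) = dnSeq s X := by
  rw [dnSeq_image_flipOn]
  have h0 : Finset.univ \ s.toFinset = (∅ : Finset (Fin n)) := by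
    ext k; simp [hs k]
  rw [h0]
  have hid : (flipOn (∅ : Finset (Fin n)) : (Fin n → Bool) → (Fin n → Bool)) = id := by
    funext x; funext k; simp [flipOn]
  rw [hid, Finset.image_id]

/-- Reflecting every coordinate is the antipode. [folklore] -/
theorem flipOn_univ_eq (x : Fin n → Bool) : flipOn Finset.univ x = fun i => !x i := by
  funext k; simp [flipOn]


end SahiFComb

end Summit.CriticalPhenomena.PercolationContinuityZ3.Theorems
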